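import Literature.AlgebraicGeometry.Resolution.AbhyankarChartTransfer
import Literature.AlgebraicGeometry.Resolution.CentreLocalRingLemmas
import Literature.AlgebraicGeometry.Resolution.InseparableLocalUniformizationDefectStep
import Literature.AlgebraicGeometry.Resolution.InseparableLocalUniformizationDescent
import HarnessLib

/-!
# Uniformization of Abhyankar valuations with separable residue field (Temkin 2013, Thm. 5.5.2, `n = 1`, `l = k`)

Topic: `Literature/AlgebraicGeometry/Resolution`. M. Temkin, *Inseparable local uniformization*,
J. Algebra 373 (2013) 65–119 = arXiv:0804.1554v3 (numbers and pages of this version), Thm. 5.5.2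
(p. 60) in the case `n = 1` with logarithmic data dropped, under the hypothesis of its last
clause — "(iii) If each `K̃ᵢ` is separable over `k` then the claims of (i) and (ii) hold true for
`l = k`" —: for a finitely generated Abhyankar valued field `K` over the trivially valued
`k ⊆ K°`, an affine `k`-model `X = Spec A` of `K°` and a finite extension of valued fields
`K₁/K` whose residue field `K̃₁` is separably generated over `k`, there is an affine refinement
`X' = Spec A'` of `X` such that the centre `x₁` of `K₁°` on `Nr_{K₁}(X')` is a simple `k`-smooth
(and regular) point. PROVED here (`temkin2013Abhyankar_separable`) from

* the named fact `Temkin2013_Thm551iii` (Thm. 5.5.1 (iii): the adapted toroidal model is étale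
  over its toric chart), taken as a hypothesis, and
* the tree's PROVED results: Prop. 5.4.3 (`Temkin2013_Prop543_holds`,
  `AbhyankarToroidalChartsProofs.lean`), Cor. 5.4.2
  (`exists_isToricMonoid_forall_mem_centreLocalRing`, `ToricChartsExhaustion.lean`), Thm. A.2.1
  (`exists_basis_lt_one_subset_closure`, `PerronTransforms.lean`), the simple-point bricks of
  `AbhyankarSimplePoints.lean` / `CentreLocalRingLemmas.lean`, Abhyankar bases
  (`AbhyankarBases.lean`) and the chart bookkeeping of `AbhyankarChartTransfer.lean`,

following the printed proof (pp. 60–61): an Abhyankar basis `B ⊂ K` (also one of `K₁`), an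
adapted basis `B'` of `K₁` (`|B'_E|` a basis of `Λ₁`, `B̃'_F` the given separating transcendence
basis); ONE free toric monoid `M ⊆ Λ₁°` (Thm. A.2.1) above the thresholds of Thm. 5.5.1 (iii)
for `B'`, of Prop. 5.4.3 for `B, B'` and (the image of) that of Cor. 5.4.2 for `B ⊂ K` and the
generators of `A`; then `X₁ := Nr_{K₁}(k[M_B])` has local ring `A_{B,M} = A_{B',M}` at `x₁`
(Prop. 5.4.3), which is `k`-smooth with separable residue field (étale over the smooth free chart
`k[M_{B'}]`, Thm. 5.5.1 (iii)); finally `X' = Spec A'` with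
`A' = k[gens of A, B_F^{±1}, x^{e₁}, …, x^{e_n}, 1/g] ⊆ K°` (`g` the value-one common
denominator of the generators of `A` in `A_{B,M} ∩ K`, Cor. 5.4.2; `x^{eᵢ}` the finite subchart of
`AbhyankarChartTransfer.lean`) refines `X`, and `Nr_{K₁}(A')` is sandwiched between `X₁` and its
local ring `A_{B,M}`, so its local ring at the centre IS `A_{B,M}` ("just shrinking `X'` … we
achieve that `X'` is affine, admits a morphism to `X` and satisfies all the other properties").

## Source

* M. Temkin, *Inseparable local uniformization*, arXiv:0804.1554v3: Thm. 5.5.2 and its proof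
  (pp. 60–61); Thm. 5.5.1 (p. 59), Prop. 5.4.3 and Cor. 5.4.2 (p. 57), Thm. A.2.1 (p. 63).
-/

noncomputable section

namespace Literature.AlgebraicGeometry.Resolution

open IsLocalRing ValuationSubring

universe u

/-! ### One free monoid above three finitely generated ones -/

section FreeMonoid

variable {L : Type u} [Field L] (O : ValuationSubring L)

/-- **Thm. A.2.1, applied**: finitely many finitely generated monoids of values `≤ 1` lie in the
free monoid on a `ℤ`-basis of `Λ` consisting of values `≤ 1` (`exists_basis_lt_one_subset_closure`).
[cite: Temkin2013, Thm. A.2.1 (p. 63) and proof of Thm. 5.5.2 (p. 60)] -/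
theorem exists_closure_basis_ge₃ [Group.FG (ValueGroup O)ˣ] {M₁ M₂ M₃ : Submonoid (ValueGroup O)ˣ}
    (h₁ : M₁.FG) (h₂ : M₂.FG) (h₃ : M₃.FG) (h₁le : M₁ ≤ valuationMonoid O)
    (h₂le : M₂ ≤ valuationMonoid O) (h₃le : M₃ ≤ valuationMonoid O) :
    ∃ (n : ℕ) (b : Module.Basis (Fin n) ℤ (Additive (ValueGroup O)ˣ)),
      M₁ ≤ Submonoid.closure (Set.range fun i => Additive.toMul (b i)) ∧
      M₂ ≤ Submonoid.closure (Set.range fun i => Additive.toMul (b i)) ∧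
      M₃ ≤ Submonoid.closure (Set.range fun i => Additive.toMul (b i)) ∧
      Submonoid.closure (Set.range fun i => Additive.toMul (b i)) ≤ valuationMonoid O := by
  classical
  obtain ⟨S₁, hS₁⟩ := h₁
  obtain ⟨S₂, hS₂⟩ := h₂
  obtain ⟨S₃, hS₃⟩ := h₃
  have hS : ∀ s ∈ S₁ ∪ S₂ ∪ S₃, s ≤ 1 := by
    intro s hs
    rw [← Units.val_le_val, Units.val_one, ← mem_valuationMonoid_iff]
    rcases Finset.mem_union.mp hs with hs | hs
    · rcases Finset.mem_union.mp hs with hs | hs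
      · exact h₁le (hS₁ ▸ Submonoid.subset_closure hs)
      · exact h₂le (hS₂ ▸ Submonoid.subset_closure hs)
    · exact h₃le (hS₃ ▸ Submonoid.subset_closure hs)
  obtain ⟨n, b, -, hsub, hle1⟩ := exists_basis_lt_one_subset_closure (S₁ ∪ S₂ ∪ S₃) hS
  refine ⟨n, b, ?_, ?_, ?_, fun m hm => ?_⟩
  · rw [← hS₁]
    exact Submonoid.closure_le.mpr fun s hs =>
      hsub (Finset.mem_union_left _ (Finset.mem_union_left _ hs))
  · rw [← hS₂]
    exact Submonoid.closure_le.mpr fun s hs =>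
      hsub (Finset.mem_union_left _ (Finset.mem_union_right _ hs))
  · rw [← hS₃]
    exact Submonoid.closure_le.mpr fun s hs => hsub (Finset.mem_union_right _ hs)
  · exact (mem_valuationMonoid_iff O).mpr (Units.val_le_val.mpr (hle1 m hm))

end FreeMonoid

/-! ### Normalizations along `K → K₁` -/

section Normalization

variable {k K K₁ : Type u} [Field k] [Field K] [Field K₁] [Algebra k K] [Algebra K K₁]
  [Algebra k K₁] [IsScalarTower k K K₁]

/-- Integral elements map to integral elements: `Nr_K(C) → Nr_{K₁}(C₁)` whenever `C` maps into
`C₁`. [folklore] -/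
theorem algebraMap_mem_nrAlg {C : Subalgebra k K} {C₁ : Subalgebra k K₁}
    (hC : C.map (IsScalarTower.toAlgHom k K K₁) ≤ C₁) {z : K} (hz : z ∈ nrAlg C) :
    algebraMap K K₁ z ∈ nrAlg C₁ := by
  let f : C →+* C₁ :=
    { toFun := fun c => ⟨algebraMap K K₁ c, hC ⟨c, c.2, rfl⟩⟩
      map_one' := Subtype.ext (map_one _)
      map_mul' := fun a b => Subtype.ext (map_mul _ _ _)
      map_zero' := Subtype.ext (map_zero _)
      map_add' := fun a b => Subtype.ext (map_add _ _ _) }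
  exact mem_nrAlg_iff.mpr ((mem_nrAlg_iff.mp hz).map_of_comp_eq f (algebraMap K K₁) (by ext; rfl))

end Normalization

/-! ### The theorem -/

section Main

variable {k K K₁ : Type u} [Field k] [Field K] [Field K₁] [Algebra k K] [Algebra K K₁]
  [Algebra k K₁] [IsScalarTower k K K₁]

/-- **Temkin 2013, Thm. 5.5.2 for `n = 1` in the residually separable case (`l = k`)** (p. 60:
"(iii) If each `K̃ᵢ` is separable over `k` then the claims of (i) and (ii) hold true for `l = k`";
conclusion of (i) for `i = 1`: "`x₁` is a simple `l`-smooth point"; setting of §5.5, p. 59: `k`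
trivially valued, `K` a finitely generated Abhyankar valued `k`-field, `X` an affine `k`-model of
`K°`, `K₁/K` a finite extension of valued fields, `X₁ = Nr_{K₁}(X')` and `x₁` the centre of
`K₁°` on it). Rendering as in `Temkin2013Abhyankar` (`InseparableLocalUniformizationAbhyankar.lean`)
with `L₁ = K₁`, `l = k`: `K° = K₁° ∩ K` (`O₁.comap`), `D_{K/k} = 0`, `X = Spec A` with `A ⊆ K°`
finitely generated and `Frac A = K`; the hypothesis "`K̃₁` separable over `k`" ↦ a finite
separating transcendence basis `s` of `K̃₁/k` (as produced by Thm. 5.5.3); the conclusion: an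
affine refinement `X' = Spec A'` (`A ≤ A' ⊆ K°`, finitely generated, `Frac A' = K`) and the
normalization `N = Nr_{K₁}(X')` (finitely generated over `k`, `Frac N = K₁`, `N ⊆ K₁°`) whose
centre `𝔭` is `k`-smooth (`Algebra.IsSmoothAt`), simple (`k(𝔭)` formally smooth over `k`) and
regular. PROVED from the named fact `Temkin2013_Thm551iii` along the printed proof (pp. 60–61);
see the module docstring. [cite: Temkin2013, Thm. 5.5.2 (p. 60 of arXiv:0804.1554v3)] -/
theorem temkin2013Abhyankar_separable (h551 : Temkin2013_Thm551iii.{u}) [FiniteDimensional K K₁]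
    (hfg : (⊤ : IntermediateField k K).FG) (O₁ : ValuationSubring K₁)
    (hk₁ : ∀ c : k, algebraMap k K₁ c ∈ O₁)
    (hD : transcendenceDefect k (O₁.comap (algebraMap K K₁)) (algebraMap_mem_comap_of_mem O₁ hk₁) = 0)
    (A : Subalgebra k K) (hAO : A.toSubring ≤ (O₁.comap (algebraMap K K₁)).toSubring) (hAfg : A.FG)
    (hAfr : IsFractionRing A K)
    (s : Finset (letI := algebraOfMem k O₁ hk₁; ResidueField O₁))
    (hs : letI := algebraOfMem k O₁ hk₁
      IsTranscendenceBasis k ((↑) : s → ResidueField O₁))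
    (hsep : letI := algebraOfMem k O₁ hk₁
      ∀ z : ResidueField O₁, IsSeparable (IntermediateField.adjoin k (s : Set (ResidueField O₁))) z) :
    ∃ (A' : Subalgebra k K), A ≤ A' ∧ A'.toSubring ≤ (O₁.comap (algebraMap K K₁)).toSubring ∧
      A'.FG ∧ IsFractionRing A' K ∧
    ∃ (N : Subalgebra k K₁) (hN : N.toSubring ≤ O₁.toSubring),
      (N : Set K₁) = {z : K₁ | IsIntegral (A'.map (IsScalarTower.toAlgHom k K K₁)) z} ∧
      N.FG ∧ IsFractionRing N K₁ ∧
      Algebra.IsSmoothAt k (centreIdeal N O₁ hN) ∧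
      Algebra.FormallySmooth k (ResidueField (Localization.AtPrime (centreIdeal N O₁ hN))) ∧
      IsRegularLocalRing (Localization.AtPrime (centreIdeal N O₁ hN)) := by
  classical
  have hk : ∀ c : k, algebraMap k K c ∈ O₁.comap (algebraMap K K₁) :=
    algebraMap_mem_comap_of_mem O₁ hk₁
  obtain ⟨hD₁, -, -, -⟩ := transcendenceDefect_eq_zero_of_finite O₁ hk₁ hfg hD
  have hfg₁ : (⊤ : IntermediateField k K₁).FG := intermediateField_fg_top_of_finite hfg
  letI ik₁ : Algebra k O₁ := algebraOfMem k O₁ hk₁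
  haveI := isScalarTower_algebraOfMem k O₁ hk₁
  haveI : Group.FG (ValueGroup O₁)ˣ := valueGroup_fg_of_transcendenceDefect_eq_zero O₁ hfg₁ hk₁ hD₁
  let φ : K →ₐ[k] K₁ := IsScalarTower.toAlgHom k K K₁
  have hφ : ∀ z : K, φ z = algebraMap K K₁ z := fun _ => rfl
  -- Abhyankar bases: `B ⊂ K`, its image in `K₁`, and an adapted `B' ⊂ K₁`
  obtain ⟨E, F, x, y, hB⟩ := exists_isAbhyankarBasis (O₁.comap (algebraMap K K₁)) hk hfg hD
  have hB₁ := hB.extension O₁ hk₁ hfg hD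
  obtain ⟨E', x', y', hB', hx'top, hy'range⟩ := exists_adapted_isAbhyankarBasis O₁ hk₁ hfg₁ hD₁ s hs
  have hsep' : ∀ z : ResidueField O₁,
      IsSeparable (IntermediateField.adjoin k (Set.range fun i => residue O₁ (y' i))) z := by
    rw [hy'range]; exact hsep
  -- thresholds: Thm. 5.5.1 (iii) for `B'`, Prop. 5.4.3 for `B, B'`, Cor. 5.4.2 for `B ⊂ K`
  obtain ⟨M₁, hM₁t, hM₁le, h551M⟩ := h551 k K₁ hfg₁ O₁ hk₁ hD₁ E' s.card x' y' hB' hx'top hsep'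
  obtain ⟨M₂, hM₂t, hM₂le, h543M⟩ := Temkin2013_Prop543_holds k K₁ hfg₁ O₁ hk₁ hD₁ E F
    (fun j => algebraMap K K₁ (x j)) (fun i => comapInclusion O₁ (y i)) hB₁ E' s.card x' y' hB'
  obtain ⟨gA, hgA⟩ := hAfg
  have hgAA : ∀ a ∈ gA, a ∈ A := fun a ha => hgA ▸ Algebra.subset_adjoin ha
  have hgAO : ∀ a ∈ gA, a ∈ O₁.comap (algebraMap K K₁) := fun a ha => hAO (hgAA a ha)
  obtain ⟨M₃, hM₃t, hM₃le, -, h542M⟩ := exists_isToricMonoid_forall_mem_centreLocalRing hfg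
    (O₁.comap (algebraMap K K₁)) hk hD x y hB gA hgAO
  -- one free monoid `M ⊆ Λ₁°` above `M₁`, `M₂` and the image of `M₃`
  set ι := unitsValueGroupHom K O₁ with hι
  have hM₃'le : M₃.map ι ≤ valuationMonoid O₁ := by
    rintro _ ⟨γ, hγ, rfl⟩
    exact (mem_valuationMonoid_iff O₁).mpr
      ((unitsValueGroupHom_le_one_iff O₁ γ).mpr ((mem_valuationMonoid_iff _).mp (hM₃le hγ)))
  obtain ⟨n, b, hM₁M, hM₂M, hM₃M, hMle⟩ := exists_closure_basis_ge₃ O₁ hM₁t.1 hM₂t.1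
    (hM₃t.1.map ι) hM₁le hM₂le hM₃'le
  set M : Submonoid (ValueGroup O₁)ˣ := Submonoid.closure (Set.range fun i => Additive.toMul (b i))
    with hMdef
  have hMt : IsToricMonoid O₁ M := isToricMonoid_closure_basis O₁ b
  -- the toroidal models of `B` and `B'` in `K₁`
  set C₁ : Subalgebra k K₁ := toricChart (k := k) O₁ (fun j => algebraMap K K₁ (x j))
    (fun i => comapInclusion O₁ (y i)) M with hC₁
  have hC₁O : C₁.toSubring ≤ O₁.toSubring :=
    toricChart_le_valuationSubring _ _ hk₁ hB₁.valuation_eq_one hMle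
  have hPO : (nrAlg C₁).toSubring ≤ O₁.toSubring := nrAlg_le_valuationSubring hC₁O
  set C' : Subalgebra k K₁ := toricChart (k := k) O₁ x' y' M with hC'
  have hC'O : C'.toSubring ≤ O₁.toSubring :=
    toricChart_le_valuationSubring x' y' hk₁ hB'.valuation_eq_one hMle
  have hP'O : (nrAlg C').toSubring ≤ O₁.toSubring := nrAlg_le_valuationSubring hC'O
  -- Prop. 5.4.3 and Thm. 5.5.1 (iii)
  have h543 : centreLocalRing O₁ (nrAlg C₁) = centreLocalRing O₁ (nrAlg C') :=
    (h543M M hMt hM₂M hMle).1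
  have het : Algebra.IsEtaleAt C' (centreIdeal (nrAlg C') O₁ hP'O) := h551M M hMt hM₁M hMle
  -- the free chart `C'`: smooth, with purely transcendental residue field, `Nr` finite over it
  haveI : Algebra.FormallySmooth k C' := formallySmooth_toricChart_free O₁ hk₁ x' y' hB' hx'top b
  haveI : Module.Finite C' (nrAlg C') :=
    module_finite_nrAlg_toricChart_free O₁ hk₁ x' y' hB' hx'top b hfg₁
  have hres' := formallySmooth_residueField_centreIdeal_toricChart O₁ hk₁ x' y' hB' hMle
  obtain ⟨hsm', hrf'⟩ :=
    isSmoothAt_and_formallySmooth_residueField_of_isEtaleAt O₁ C' hC'O hres' het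
  -- the `K`-side chart of `B` and Cor. 5.4.2 for the generators of `A`
  set MK : Submonoid (ValueGroup (O₁.comap (algebraMap K K₁)))ˣ := M.comap ι with hMK
  have hMKle : MK ≤ valuationMonoid (O₁.comap (algebraMap K K₁)) := comap_le_valuationMonoid O₁ hMle
  have hM₃MK : M₃ ≤ MK := fun γ hγ => Submonoid.mem_comap.mpr (hM₃M ⟨γ, hγ, rfl⟩)
  set CK : Subalgebra k K := toricChart (k := k) (O₁.comap (algebraMap K K₁)) x y MK with hCK
  have hCKO : CK.toSubring ≤ (O₁.comap (algebraMap K K₁)).toSubring :=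
    toricChart_le_valuationSubring x y hk hB.valuation_eq_one hMKle
  have hCKC₁ : CK.map φ ≤ C₁ := map_toricChart_comap_le O₁ x y M
  have h542 : ∀ a ∈ gA, a ∈ centreLocalRing (O₁.comap (algebraMap K K₁)) (nrAlg CK) :=
    h542M MK hM₃MK
  choose! p hp q hq hq1 hpq using fun a (ha : a ∈ gA) =>
    (mem_centreLocalRing_iff.mp (h542 a ha) :
      ∃ p ∈ nrAlg CK, ∃ q ∈ nrAlg CK, (O₁.comap (algebraMap K K₁)).valuation q = 1 ∧ a = p / q)
  set g : K := ∏ a ∈ gA, q a with hgdef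
  have hgN : g ∈ nrAlg CK := prod_mem fun a ha => hq a ha
  have hg1 : (O₁.comap (algebraMap K K₁)).valuation g = 1 := by
    rw [hgdef, map_prod]
    exact Finset.prod_eq_one fun a ha => hq1 a ha
  have hg0 : g ≠ 0 := ne_zero_of_valuation_eq_one hg1
  -- images in `K₁`: `Nr_K(CK) → Nr_{K₁}(C₁)`, value-one elements stay value-one
  have hval₁ : ∀ z : K, (O₁.comap (algebraMap K K₁)).valuation z = 1 →
      O₁.valuation (algebraMap K K₁ z) = 1 := fun z hz => by
    rw [← valueGroupHom_valuation K O₁, hz, map_one]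
  have hmapN : ∀ z ∈ nrAlg CK, algebraMap K K₁ z ∈ nrAlg C₁ := fun z hz => algebraMap_mem_nrAlg hCKC₁ hz
  -- the finite subchart of `B ⊂ K₁` and its monomials, taken in `K`
  obtain ⟨e, heval, hPeq⟩ := exists_finite_subchart O₁ hk₁ hB₁ fun i => Additive.toMul (b i)
  set m : Fin n → K := fun i => (e i).prod fun j (n : ℤ) => x j ^ n with hmdef
  have hm₁ : ∀ i, algebraMap K K₁ (m i) = (e i).prod fun j (n : ℤ) => algebraMap K K₁ (x j) ^ n :=
    fun i => algebraMap_lmonomial x (e i)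
  have hmval : ∀ i, ValMem (O₁.comap (algebraMap K K₁)) MK (m i) := fun i =>
    (valMem_comap_iff O₁ M (m i)).mpr (by rw [hm₁]; exact heval i)
  have hmO : ∀ i, m i ∈ O₁.comap (algebraMap K K₁) := fun i =>
    (hmval i).mem_valuationSubring _ hMKle
  have hmCK : ∀ i, m i ∈ CK := fun i => lmonomial_mem_toricChart x y (e i) (hmval i)
  -- the refined model `A' = k[gens A, y^{±1}, x^{eᵢ}, 1/g]`
  set T : Finset K := gA ∪ (Finset.univ.image fun i => (y i : K)) ∪
    (Finset.univ.image fun i => (y i : K)⁻¹) ∪ Finset.univ.image m ∪ {g⁻¹} with hTdef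
  have hTmem : ∀ t ∈ T, t ∈ gA ∨ (∃ i, t = (y i : K)) ∨ (∃ i, t = (y i : K)⁻¹) ∨
      (∃ i, t = m i) ∨ t = g⁻¹ := by
    intro t ht
    simp only [hTdef, Finset.mem_union, Finset.mem_image, Finset.mem_univ, true_and,
      Finset.mem_singleton] at ht
    rcases ht with (((ht | ⟨i, rfl⟩) | ⟨i, rfl⟩) | ⟨i, rfl⟩) | rfl
    · exact Or.inl ht
    · exact Or.inr (Or.inl ⟨i, rfl⟩)
    · exact Or.inr (Or.inr (Or.inl ⟨i, rfl⟩))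
    · exact Or.inr (Or.inr (Or.inr (Or.inl ⟨i, rfl⟩)))
    · exact Or.inr (Or.inr (Or.inr (Or.inr rfl)))
  have hgAT : (gA : Set K) ⊆ T := fun t ht => by
    simp only [hTdef, Finset.coe_union, Set.mem_union, Finset.mem_coe]
    exact Or.inl (Or.inl (Or.inl (Or.inl ht)))
  have hyT : ∀ i, (y i : K) ∈ T := fun i => by
    simp only [hTdef, Finset.mem_union, Finset.mem_image, Finset.mem_univ, true_and]
    exact Or.inl (Or.inl (Or.inl (Or.inr ⟨i, rfl⟩)))
  have hyiT : ∀ i, (y i : K)⁻¹ ∈ T := fun i => by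
    simp only [hTdef, Finset.mem_union, Finset.mem_image, Finset.mem_univ, true_and]
    exact Or.inl (Or.inl (Or.inr ⟨i, rfl⟩))
  have hmT : ∀ i, m i ∈ T := fun i => by
    simp only [hTdef, Finset.mem_union, Finset.mem_image, Finset.mem_univ, true_and]
    exact Or.inl (Or.inr ⟨i, rfl⟩)
  have hgT : g⁻¹ ∈ T := by simp [hTdef]
  set A' : Subalgebra k K := Algebra.adjoin k (T : Set K) with hA'def
  have hA'fg : A'.FG := ⟨T, rfl⟩
  have hAA' : A ≤ A' := by
    rw [← hgA]
    exact Algebra.adjoin_mono hgAT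
  -- `A' ⊆ K°`
  have hy1 : ∀ i, (O₁.comap (algebraMap K K₁)).valuation (y i : K) = 1 := hB.valuation_eq_one
  have hA'O : A'.toSubring ≤ (O₁.comap (algebraMap K K₁)).toSubring := by
    let O' : Subalgebra k K :=
      { (O₁.comap (algebraMap K K₁)).toSubring.toSubsemiring with algebraMap_mem' := hk }
    intro t ht
    refine (show A' ≤ O' from Algebra.adjoin_le ?_) ht
    intro t ht
    rcases hTmem t ht with ht | ⟨i, rfl⟩ | ⟨i, rfl⟩ | ⟨i, rfl⟩ | rfl
    · exact hgAO t ht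
    · exact (y i).2
    · change (y i : K)⁻¹ ∈ O₁.comap (algebraMap K K₁)
      rw [← ValuationSubring.valuation_le_one_iff, map_inv₀, hy1, inv_one]
    · exact hmO i
    · change g⁻¹ ∈ O₁.comap (algebraMap K K₁)
      rw [← ValuationSubring.valuation_le_one_iff, map_inv₀, hg1, inv_one]
  -- `Frac A' = K`
  haveI : IsFractionRing A K := hAfr
  have hA'fr : IsFractionRing A' K := by
    refine IsFractionRing.of_field A' K fun z => ?_
    obtain ⟨a, c, -, rfl⟩ := IsFractionRing.div_surjective (A := A) z
    exact ⟨⟨a, hAA' a.2⟩, ⟨c, hAA' c.2⟩, rfl⟩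
  -- `A'` maps into the local ring `A_{B,M} = (Nr_{K₁} C₁)_𝔭 ⊆ K₁`
  have hA'loc : A'.map φ ≤ centreLocalRing O₁ (nrAlg C₁) := by
    rw [Subalgebra.map_le]
    refine Algebra.adjoin_le fun t ht => ?_
    rw [SetLike.mem_coe, Subalgebra.mem_comap, hφ]
    rcases hTmem t ht with ht | ⟨i, rfl⟩ | ⟨i, rfl⟩ | ⟨i, rfl⟩ | rfl
    · rw [hpq t ht, map_div₀]
      exact div_mem_centreLocalRing (hmapN _ (hp t ht)) (hmapN _ (hq t ht)) (hval₁ _ (hq1 t ht))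
    · exact le_centreLocalRing _ (le_nrAlg _ (coe_mem_toricChart
        (fun j => algebraMap K K₁ (x j)) (fun i => comapInclusion O₁ (y i)) M i))
    · rw [map_inv₀]
      exact le_centreLocalRing _ (le_nrAlg _ (inv_coe_mem_toricChart
        (fun j => algebraMap K K₁ (x j)) (fun i => comapInclusion O₁ (y i)) M i))
    · exact le_centreLocalRing _ (le_nrAlg _ (hCKC₁ ⟨m i, hmCK i, rfl⟩))
    · rw [map_inv₀]
      exact inv_mem_centreLocalRing_of_valuation_eq_one
        (le_centreLocalRing _ (hmapN _ hgN)) (hval₁ _ hg1)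
  -- the finite subchart lies in the image of `A'`
  have hsubA' : Algebra.adjoin k ((Set.range fun i => (comapInclusion O₁ (y i) : K₁)) ∪
      (Set.range fun i => (comapInclusion O₁ (y i) : K₁)⁻¹) ∪
      Set.range fun i => (e i).prod fun j (n : ℤ) => algebraMap K K₁ (x j) ^ n) ≤ A'.map φ := by
    refine Algebra.adjoin_le ?_
    rintro t ((⟨i, rfl⟩ | ⟨i, rfl⟩) | ⟨i, rfl⟩)
    · exact ⟨(y i : K), Algebra.subset_adjoin (hyT i), rfl⟩
    · exact ⟨(y i : K)⁻¹, Algebra.subset_adjoin (hyiT i), by rw [map_inv₀]; rfl⟩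
    · exact ⟨m i, Algebra.subset_adjoin (hmT i), hm₁ i⟩
  -- the normalization `N = Nr_{K₁}(A')`
  obtain ⟨N, hNcar, hNfg, hNfr, -⟩ := exists_normalisation_in_extension A' hA'fg hA'fr K₁
  have hmemN : ∀ z : K₁, z ∈ N ↔ IsIntegral (A'.map φ) z := fun z => by
    rw [← SetLike.mem_coe, hNcar]; rfl
  have hNO : N.toSubring ≤ O₁.toSubring := fun z hz => by
    refine mem_of_isIntegral_of_le (V := O₁) (S := (A'.map φ).toSubring) ?_ ((hmemN z).mp hz)
    rintro _ ⟨a, ha, rfl⟩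
    exact hA'O ha
  -- sandwich: `Nr_{K₁}(C₁) ≤ N ≤ (Nr_{K₁} C₁)_𝔭`
  have hPN : nrAlg C₁ ≤ N := by
    intro z hz
    rw [hC₁, hMdef, hPeq] at hz
    exact (hmemN z).mpr (mem_nrAlg_iff.mp (nrAlg_mono hsubA' hz))
  have hNP : N ≤ centreLocalRing O₁ (nrAlg C₁) := fun z hz =>
    mem_centreLocalRing_nrAlg_of_isIntegral (isIntegral_of_subalgebra_le (A'.map φ)
      (centreLocalRing O₁ (nrAlg C₁)) (fun _ h' => hA'loc h') ((hmemN z).mp hz))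
  have hloc : centreLocalRing O₁ N = centreLocalRing O₁ (nrAlg C') :=
    (centreLocalRing_eq_of_le_of_le hPN hNP).trans h543
  -- conclusions, transported along `N_𝔭 = A_{B,M} = A_{B',M}`
  have hsmN : Algebra.IsSmoothAt k (centreIdeal N O₁ hNO) := isSmoothAt_centreIdeal_of_eq hloc hsm'
  have hrfN : Algebra.FormallySmooth k
      (ResidueField (Localization.AtPrime (centreIdeal N O₁ hNO))) :=
    formallySmooth_residueField_centreIdeal_of_eq hloc hrf'
  haveI : Algebra.FiniteType k N := (Subalgebra.fg_iff_finiteType N).mp hNfg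
  haveI : Algebra.FinitePresentation k N :=
    (Algebra.FinitePresentation.of_finiteType (R := k) (A := N)).mp inferInstance
  haveI := hsmN
  have hreg : IsRegularLocalRing (Localization.AtPrime (centreIdeal N O₁ hNO)) :=
    isRegularLocalRing_of_isSmoothAt k N (centreIdeal N O₁ hNO)
  exact ⟨A', hAA', hA'O, hA'fg, hA'fr, N, hNO, hNcar, hNfg, hNfr, hsmN, hrfN, hreg⟩


/-- **Thm. 5.5.2 (`n = 1`, `l = k`) with a prescribed finite subset of `K°` instead of a model**
(the form actually established on p. 61: "taking a sufficiently large `M` we can also achieve that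
the local ring `A_{B,M}` of `x'` contains any finite subset of `K°`"): the refined affine model
`X' = Spec A'` can be required to contain any finite `Z ⊆ K°` — apply
`temkin2013Abhyankar_separable` to the model generated by `Z` and an affine model of `K°`
(`exists_affineModel`). [cite: Temkin2013, Thm. 5.5.2 and its proof (pp. 60–61 of arXiv:0804.1554v3)] -/
theorem temkin2013Abhyankar_separable_finset (h551 : Temkin2013_Thm551iii.{u})
    [FiniteDimensional K K₁] (hfg : (⊤ : IntermediateField k K).FG) (O₁ : ValuationSubring K₁)
    (hk₁ : ∀ c : k, algebraMap k K₁ c ∈ O₁)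
    (hD : transcendenceDefect k (O₁.comap (algebraMap K K₁)) (algebraMap_mem_comap_of_mem O₁ hk₁) = 0)
    (Z : Finset K) (hZ : ∀ z ∈ Z, z ∈ O₁.comap (algebraMap K K₁))
    (s : Finset (letI := algebraOfMem k O₁ hk₁; ResidueField O₁))
    (hs : letI := algebraOfMem k O₁ hk₁
      IsTranscendenceBasis k ((↑) : s → ResidueField O₁))
    (hsep : letI := algebraOfMem k O₁ hk₁
      ∀ z : ResidueField O₁, IsSeparable (IntermediateField.adjoin k (s : Set (ResidueField O₁))) z) :
    ∃ (A' : Subalgebra k K), (Z : Set K) ⊆ A' ∧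
      A'.toSubring ≤ (O₁.comap (algebraMap K K₁)).toSubring ∧ A'.FG ∧ IsFractionRing A' K ∧
    ∃ (N : Subalgebra k K₁) (hN : N.toSubring ≤ O₁.toSubring),
      (N : Set K₁) = {z : K₁ | IsIntegral (A'.map (IsScalarTower.toAlgHom k K K₁)) z} ∧
      N.FG ∧ IsFractionRing N K₁ ∧
      Algebra.IsSmoothAt k (centreIdeal N O₁ hN) ∧
      Algebra.FormallySmooth k (ResidueField (Localization.AtPrime (centreIdeal N O₁ hN))) ∧
      IsRegularLocalRing (Localization.AtPrime (centreIdeal N O₁ hN)) := by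
  classical
  have hk : ∀ c : k, algebraMap k K c ∈ O₁.comap (algebraMap K K₁) :=
    algebraMap_mem_comap_of_mem O₁ hk₁
  obtain ⟨A₀, hA₀O, ⟨g₀, hg₀⟩, hA₀fr⟩ := exists_affineModel k K hfg (O₁.comap (algebraMap K K₁)) hk
  set A : Subalgebra k K := Algebra.adjoin k ((Z ∪ g₀ : Finset K) : Set K) with hAdef
  have hA₀A : A₀ ≤ A := by
    rw [← hg₀]
    exact Algebra.adjoin_mono fun t ht => by
      rw [Finset.coe_union]; exact Or.inr ht
  have hZA : (Z : Set K) ⊆ A := fun t ht => Algebra.subset_adjoin (by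
    rw [Finset.coe_union]; exact Or.inl ht)
  have hAO : A.toSubring ≤ (O₁.comap (algebraMap K K₁)).toSubring := by
    let O' : Subalgebra k K :=
      { (O₁.comap (algebraMap K K₁)).toSubring.toSubsemiring with algebraMap_mem' := hk }
    intro t ht
    refine (show A ≤ O' from Algebra.adjoin_le ?_) ht
    intro t ht
    rw [Finset.coe_union] at ht
    rcases ht with ht | ht
    · exact hZ t ht
    · exact hA₀O (hg₀ ▸ Algebra.subset_adjoin ht)
  haveI : IsFractionRing A₀ K := hA₀fr
  have hAfr : IsFractionRing A K := by
    refine IsFractionRing.of_field A K fun z => ?_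
    obtain ⟨a, c, -, rfl⟩ := IsFractionRing.div_surjective (A := A₀) z
    exact ⟨⟨a, hA₀A a.2⟩, ⟨c, hA₀A c.2⟩, rfl⟩
  obtain ⟨A', hAA', hA'O, hA'fg, hA'fr, hrest⟩ := temkin2013Abhyankar_separable h551 hfg O₁ hk₁ hD A
    hAO ⟨Z ∪ g₀, rfl⟩ hAfr s hs hsep
  exact ⟨A', hZA.trans hAA', hA'O, hA'fg, hA'fr, hrest⟩

end Main

end Literature.AlgebraicGeometry.Resolution

end
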